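import Literature.AlgebraicGeometry.Resolution.GeneralizedStabilityLemma55VT
import Mathlib.FieldTheory.PurelyInseparable.PerfectClosure
import Mathlib.FieldTheory.PurelyInseparable.Exponent
import Mathlib.FieldTheory.SeparableClosure
import Mathlib.FieldTheory.Relrank
import HarnessLib

/-!
# Separating elements of function fields of transcendence degree one: the `K·F^p` criterion

Topic: `Literature/AlgebraicGeometry/Resolution` (valued function fields). PROVED classical field
theory behind the discharge of the named fact `Kuhlmann2019_Lemma54`
(`Kuhlmann2019HenselianRationalitySteps.lean` = F.-V. Kuhlmann, *Elimination of ramification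
II*, Israel J. Math. 234 (2019) = arXiv:1701.05508, Lemma 5.4: separating elements with
prescribed value), whose printed proof rests on "at least one of the elements `x, x+az, x+a`
must be a separating element for the separable extension `K(x,x+az,x+a)|K` (cf. [24, VIII, §4,
Proposition 4.8])" — Lang's form of Mac Lane's theorem that a separating transcendence basis can
be chosen among any set of generators of a finitely generated separable extension. We prove the
special case of transcendence degree `1` in the classical form of the **`K·F^p` criterion**:
for a separably generated `F|K` of transcendence degree `1` in characteristic `p > 0` (with a
separating element `z`),

* `K·F^p = K(F^p)` does not contain `z` (`not_mem_compositumPow_of_separating`), and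
  `K(z) ∩ K·F^p = K(z^p)` (`mem_closure_pow_of_mem_compositumPow`);
* `F = K·F^p(z)` (`le_closure_compositumPow_insert`) and `[F : K·F^p] = p`, so `F = K·F^p(y)`
  for every `y ∈ F ∖ K·F^p` (`le_closure_compositumPow_insert_of_not_mem`);
* a transcendental `y ∈ F ∖ K·F^p` is a separating element: `F|K(y)` is separable algebraic
  (`isSeparable_adjoin_of_not_mem_compositumPow`) — from `F = K(y)·F^{p^n}` for all `n`
  (`le_closure_adjoin_pow_iterate`) and the finite exponent of `F` over the relative separable
  closure of `K(y)`.

The elementary inputs (`mem_of_isSeparable_of_pow_mem`: a separable `x` with `x^p ∈ E` lies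
in `E`; `not_mem_closure_pow_of_transcendental`: `z ∉ K(z^p)`; `transcendental_of_mem_closure`:
elements of `K(z) ∖ K` are transcendental) are proved from Mathlib
(`separableClosure_inf_perfectClosure`, `Polynomial.expand`, transitivity of algebraicity).
Everything is [folklore] (Lang, *Algebra*, VIII §4; Jacobson, *Basic Algebra II*, §8.16); no
named facts.

## Rendering notes

Ambient rendering as in `ValuedFunctionFields.lean`: `K ≤ F` subfields of a field `Ω` of
characteristic `p`, `K(z) = Subfield.closure (K ∪ {z})`, `K·F^p = Subfield.closure (K ∪ F^p)`
with `F^p = (· ^ p) '' F`; "`z` is a separating element of `F|K`" = every element of `F` is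
separable over `K(z)`.
-/

noncomputable section

open Polynomial

namespace Literature.AlgebraicGeometry.Resolution

universe u

variable {Ω : Type u} [Field Ω]

/-! ### Three elementary inputs -/

section Elementary

/-- **A separable element whose `p`-th power lies in `E` lies in `E`** (`p` the exponential
characteristic): it is separable and purely inseparable over `E`. [folklore] -/
theorem mem_of_isSeparable_of_pow_mem (E : Subfield Ω) (q : ℕ) [ExpChar Ω q] {x : Ω}
    (hsep : IsSeparable E x) (hx : x ^ q ∈ E) : x ∈ E := by
  haveI : ExpChar E q := Subfield.expChar E q
  have h1 : x ∈ separableClosure E Ω := mem_separableClosure_iff.mpr hsep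
  have h2 : x ∈ perfectClosure E Ω := by
    rw [mem_perfectClosure_iff_pow_mem q]
    exact ⟨1, ⟨x ^ q, hx⟩, by rw [pow_one]; rfl⟩
  have h3 : x ∈ separableClosure E Ω ⊓ perfectClosure E Ω := IntermediateField.mem_inf.mpr ⟨h1, h2⟩
  rw [separableClosure_inf_perfectClosure, IntermediateField.mem_bot] at h3
  obtain ⟨c, hc⟩ := h3
  rw [← hc]
  exact c.2

/-- **`z ∉ K(z^p)` for `z` transcendental over `K` and `p > 1`**: a relation
`z · s(z^p) = r(z^p)` is a non-trivial polynomial relation for `z` (the coefficient of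
`X^{pi+1}` on the left is `sᵢ`, on the right `0`). [folklore] -/
theorem not_mem_closure_pow_of_transcendental (K : Subfield Ω) {p : ℕ} (hp : 1 < p) {z : Ω}
    (hz : Transcendental K z) : z ∉ Subfield.closure ((K : Set Ω) ∪ {z ^ p}) := by
  classical
  intro hmem
  rw [← mem_adjoin_subfield_iff] at hmem
  obtain ⟨r, s, h⟩ := (IntermediateField.mem_adjoin_simple_iff K z).mp hmem
  have hz0 : z ≠ 0 := fun h0 => hz (h0 ▸ isAlgebraic_zero)
  have hs : aeval (z ^ p) s ≠ 0 := fun h0 => by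
    rw [h0, div_zero] at h
    exact hz0 h
  have hs0 : s ≠ 0 := fun h0 => hs (by rw [h0, map_zero])
  -- the relation `z · s(z^p) - r(z^p) = 0`
  have hzs : z * aeval (z ^ p) s = aeval (z ^ p) r := (eq_div_iff hs).mp h
  set P : Polynomial K := X * expand K p s - expand K p r with hP
  have hPz : aeval z P = 0 := by
    rw [hP, map_sub, map_mul, aeval_X, expand_aeval, expand_aeval, hzs, sub_self]
  have hP0 : P ≠ 0 := by
    obtain ⟨i, hi⟩ : ∃ i, s.coeff i ≠ 0 := by
      by_contra hall
      push Not at hall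
      exact hs0 (Polynomial.ext fun i => by rw [hall i, coeff_zero])
    intro h0
    have hc := congrArg (fun Q : Polynomial K => Q.coeff (p * i + 1)) h0
    simp only [hP, coeff_sub, coeff_X_mul, coeff_expand (lt_trans zero_lt_one hp), coeff_zero] at hc
    have hndvd : ¬ p ∣ p * i + 1 := fun hd => by
      have := (Nat.dvd_add_right (dvd_mul_right p i)).mp hd
      exact absurd (Nat.le_of_dvd one_pos this) (not_le.mpr hp)
    rw [if_pos (dvd_mul_right p i), if_neg hndvd, sub_zero,
      Nat.mul_div_cancel_left _ (lt_trans zero_lt_one hp)] at hc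
    exact hi hc
  exact hz ⟨P, hP0, hPz⟩

/-- **Elements of `K(z) ∖ K` are transcendental over `K`** (`z` transcendental): if
`w = r(z)/s(z) ∉ K` then `z` is a root of `r(X) - w·s(X) ≠ 0` over `K(w)`, so an algebraic `w`
would make `z` algebraic. [folklore] -/
theorem transcendental_of_mem_closure (K : Subfield Ω) {z w : Ω} (hz : Transcendental K z)
    (hw : w ∈ Subfield.closure ((K : Set Ω) ∪ {z})) (hwK : w ∉ K) : Transcendental K w := by
  classical
  intro hwalg
  rw [← mem_adjoin_subfield_iff] at hw
  obtain ⟨r, s, h⟩ := (IntermediateField.mem_adjoin_simple_iff K w).mp hw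
  have hw0 : w ≠ 0 := fun h0 => hwK (h0 ▸ K.zero_mem)
  have hs : aeval z s ≠ 0 := fun h0 => by
    rw [h0, div_zero] at h
    exact hw0 h
  -- `z` is algebraic over `K⟮w⟯`
  let Kw : IntermediateField K Ω := IntermediateField.adjoin K ({w} : Set Ω)
  haveI : Algebra.IsAlgebraic K Kw :=
    IntermediateField.isAlgebraic_adjoin_simple hwalg.isIntegral
  have hwKw : w ∈ Kw := IntermediateField.mem_adjoin_simple_self K w
  set Q : Polynomial Kw := r.map (algebraMap K Kw) - C (⟨w, hwKw⟩ : Kw) * s.map (algebraMap K Kw)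
    with hQ
  have hQz : aeval z Q = 0 := by
    rw [hQ, map_sub, map_mul, aeval_map_algebraMap, aeval_map_algebraMap, aeval_C]
    change aeval z r - w * aeval z s = 0
    rw [h, div_mul_cancel₀ _ hs, sub_self]
  have hQ0 : Q ≠ 0 := by
    intro h0
    -- coefficientwise `rᵢ = w sᵢ`; at an index with `sᵢ ≠ 0` this puts `w` in `K`
    have hs0 : s ≠ 0 := fun h0' => hs (by rw [h0', map_zero])
    obtain ⟨i, hi⟩ : ∃ i, s.coeff i ≠ 0 := by
      by_contra hall
      push Not at hall
      exact hs0 (Polynomial.ext fun i => by rw [hall i, coeff_zero])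
    have hc := congrArg (fun P : Polynomial Kw => (P.coeff i : Ω)) h0
    simp only [hQ, coeff_sub, coeff_C_mul, coeff_map, coeff_zero] at hc
    change ((r.coeff i : K) : Ω) - w * ((s.coeff i : K) : Ω) = ((0 : Kw) : Ω) at hc
    have hsi : ((s.coeff i : K) : Ω) ≠ 0 := fun h0' => hi (Subtype.ext h0')
    have hw' : w = ((r.coeff i : K) : Ω) / ((s.coeff i : K) : Ω) := by
      rw [eq_div_iff hsi]
      have : ((0 : Kw) : Ω) = 0 := rfl
      rw [this, sub_eq_zero] at hc
      exact hc.symm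
    exact hwK (hw' ▸ K.div_mem (r.coeff i).2 (s.coeff i).2)
  have hzKw : IsAlgebraic Kw z := ⟨Q, hQ0, hQz⟩
  exact hz ((isIntegral_trans (R := K) z hzKw.isIntegral).isAlgebraic)

end Elementary

/-! ### The compositum `K·F^p` and the separating element `z` -/

section CharP

variable (p : ℕ) [Fact p.Prime] [CharP Ω p]

/-- `c ∈ K(z) ⇒ c^p ∈ K(z^p)` (Frobenius maps `K(z)` into `K^p(z^p) ⊆ K(z^p)`). [folklore] -/
theorem pow_mem_closure_pow (K : Subfield Ω) (z : Ω) {c : Ω}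
    (hc : c ∈ Subfield.closure ((K : Set Ω) ∪ {z})) :
    c ^ p ∈ Subfield.closure ((K : Set Ω) ∪ {z ^ p}) := by
  have h1 : frobenius Ω p c ∈ (Subfield.closure ((K : Set Ω) ∪ {z})).map (frobenius Ω p) :=
    Subfield.mem_map.mpr ⟨c, hc, rfl⟩
  rw [RingHom.map_field_closure] at h1
  rw [← frobenius_def]
  refine Subfield.closure_mono ?_ h1
  rintro _ ⟨a, ha | ha, rfl⟩
  · exact Or.inl (by rw [frobenius_def]; exact K.pow_mem ha p)
  · rw [Set.mem_singleton_iff] at ha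
    rw [ha, frobenius_def]
    exact Or.inr rfl

/-- **`b^p` is separable over `K(z^p)` if `b` is separable over `K(z)`**: apply Frobenius to
the (separable) minimal polynomial of `b` over `K(z)`. [folklore] -/
theorem isSeparable_pow_of_isSeparable_closure (K : Subfield Ω) (z : Ω) {b : Ω}
    (hb : IsSeparable (Subfield.closure ((K : Set Ω) ∪ {z})) b) :
    IsSeparable (Subfield.closure ((K : Set Ω) ∪ {z ^ p})) (b ^ p) := by
  set Kz : Subfield Ω := Subfield.closure ((K : Set Ω) ∪ {z}) with hKz
  set Kzp : Subfield Ω := Subfield.closure ((K : Set Ω) ∪ {z ^ p}) with hKzp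
  have hint : IsIntegral Kz b := hb.isIntegral
  set f : Polynomial Kz := minpoly Kz b with hf
  have hfsep : f.Separable := hb
  set φ : Kz →+* Ω := (frobenius Ω p).comp (algebraMap Kz Ω) with hφ
  set g : Polynomial Ω := f.map φ with hg
  have hgsep : g.Separable := hfsep.map
  have hgb : g.eval (b ^ p) = 0 := by
    rw [hg, eval_map, hφ, ← frobenius_def, ← Polynomial.hom_eval₂, ← aeval_def, minpoly.aeval,
      map_zero]
  -- the coefficients of `g` lie in `K(z^p)`
  have hcoeff : ∀ k, g.coeff k ∈ Set.range (algebraMap Kzp Ω) := fun k => by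
    rw [hg, coeff_map, hφ, RingHom.comp_apply, frobenius_def]
    exact ⟨⟨_, pow_mem_closure_pow p K z (f.coeff k).2⟩, rfl⟩
  obtain ⟨g', hg'⟩ := (Polynomial.mem_lifts g).mp ((Polynomial.lifts_iff_coeff_lifts g).mpr hcoeff)
  have hg'sep : g'.Separable := (Polynomial.separable_map (algebraMap Kzp Ω)).mp (hg' ▸ hgsep)
  have hg'b : aeval (b ^ p) g' = 0 := by rw [aeval_def, ← eval_map, hg', hgb]
  exact hg'sep.of_dvd (minpoly.dvd Kzp (b ^ p) hg'b)

variable {p}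

/-- **Every element of `K·F^p` is separable over `K(z^p)`** when every element of `F` is
separable over `K(z)`. [folklore] -/
theorem isSeparable_of_mem_compositumPow {K F : Subfield Ω} {z : Ω}
    (hsepz : ∀ b ∈ F, IsSeparable (Subfield.closure ((K : Set Ω) ∪ {z})) b) {u : Ω}
    (hu : u ∈ Subfield.closure ((K : Set Ω) ∪ frobenius Ω p '' (F : Set Ω))) :
    IsSeparable (Subfield.closure ((K : Set Ω) ∪ {z ^ p})) u := by
  set Kzp : Subfield Ω := Subfield.closure ((K : Set Ω) ∪ {z ^ p}) with hKzp
  have hKKzp : K ≤ Kzp := fun c hc => Subfield.subset_closure (Or.inl hc)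
  have hu' : u ∈ Subfield.closure ((Kzp : Set Ω) ∪ frobenius Ω p '' (F : Set Ω)) :=
    Subfield.closure_mono (Set.union_subset_union_left _ hKKzp) hu
  refine isSeparable_of_mem_closure (fun x hx => ?_) hu'
  obtain ⟨b, hb, rfl⟩ := hx
  rw [frobenius_def]
  exact isSeparable_pow_of_isSeparable_closure p K z (hsepz b hb)

/-- **A separating element does not lie in `K·F^p`** (the heart of "`z` is separating iff
`dz ≠ 0`"): otherwise `z` would be separable over `K(z^p)`, over which it is purely inseparable,
so `z ∈ K(z^p)` — impossible for a transcendental `z`. [folklore] -/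
theorem not_mem_compositumPow_of_separating {K F : Subfield Ω} {z : Ω} (hz : Transcendental K z)
    (hsepz : ∀ b ∈ F, IsSeparable (Subfield.closure ((K : Set Ω) ∪ {z})) b) :
    z ∉ Subfield.closure ((K : Set Ω) ∪ frobenius Ω p '' (F : Set Ω)) := fun hmem =>
  not_mem_closure_pow_of_transcendental K (Fact.out : p.Prime).one_lt hz
    (mem_of_isSeparable_of_pow_mem _ p (isSeparable_of_mem_compositumPow hsepz hmem)
      (Subfield.subset_closure (Or.inr rfl)))

/-- **`K(z) ∩ K·F^p = K(z^p)`** (the inclusion `⊆`): an element of `K(z)` lying in `K·F^p` is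
separable over `K(z^p)` and has its `p`-th power there. [folklore] -/
theorem mem_closure_pow_of_mem_compositumPow {K F : Subfield Ω} {z : Ω}
    (hsepz : ∀ b ∈ F, IsSeparable (Subfield.closure ((K : Set Ω) ∪ {z})) b) {u : Ω}
    (huz : u ∈ Subfield.closure ((K : Set Ω) ∪ {z}))
    (hu : u ∈ Subfield.closure ((K : Set Ω) ∪ frobenius Ω p '' (F : Set Ω))) :
    u ∈ Subfield.closure ((K : Set Ω) ∪ {z ^ p}) :=
  mem_of_isSeparable_of_pow_mem _ p (isSeparable_of_mem_compositumPow hsepz hu)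
    (pow_mem_closure_pow p K z huz)

/-- **`F ⊆ K·F^p(z)`** (i.e. `F = K(z)·F^p`): an element of `F` is separable over
`K(z) ⊆ K·F^p(z)` and has its `p`-th power in `K·F^p`. [folklore] -/
theorem le_closure_compositumPow_insert {K F : Subfield Ω} {z : Ω}
    (hsepz : ∀ b ∈ F, IsSeparable (Subfield.closure ((K : Set Ω) ∪ {z})) b) :
    F ≤ Subfield.closure
      ((Subfield.closure ((K : Set Ω) ∪ frobenius Ω p '' (F : Set Ω)) : Set Ω) ∪ {z}) := by
  set KFp : Subfield Ω := Subfield.closure ((K : Set Ω) ∪ frobenius Ω p '' (F : Set Ω)) with hKFp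
  set M : Subfield Ω := Subfield.closure ((KFp : Set Ω) ∪ {z}) with hM
  have hKzM : Subfield.closure ((K : Set Ω) ∪ {z}) ≤ M :=
    Subfield.closure_mono (Set.union_subset_union_left _ fun c hc => Subfield.subset_closure (Or.inl hc))
  intro x hx
  refine mem_of_isSeparable_of_pow_mem M p (isSeparable_of_subfield_le hKzM (hsepz x hx)) ?_
  refine Subfield.subset_closure (Or.inl ?_)
  exact Subfield.subset_closure (Or.inr ⟨x, hx, frobenius_def ..⟩)

/-- **`[F : K·F^p] = p` and `F = K·F^p(y)` for `y ∈ F ∖ K·F^p`**: the minimal polynomial of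
`z ∈ F` over `K·F^p` divides `X^p - z^p = (X - z)^p`, so it is `(X - z)^k`; its second
coefficient `-kz` lies in `K·F^p ∌ z`, forcing `p ∣ k`, `k = p`; an element `y ∈ F` outside
`K·F^p` then generates the extension `K·F^p(z) ⊇ F` of prime degree. [folklore] -/
theorem le_closure_compositumPow_insert_of_not_mem {K F : Subfield Ω} {z : Ω}
    (hz : Transcendental K z) (hzF : z ∈ F)
    (hsepz : ∀ b ∈ F, IsSeparable (Subfield.closure ((K : Set Ω) ∪ {z})) b) {y : Ω} (hyF : y ∈ F)
    (hy : y ∉ Subfield.closure ((K : Set Ω) ∪ frobenius Ω p '' (F : Set Ω))) :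
    F ≤ Subfield.closure
      ((Subfield.closure ((K : Set Ω) ∪ frobenius Ω p '' (F : Set Ω)) : Set Ω) ∪ {y}) := by
  have hp : (p : ℕ).Prime := Fact.out
  set M₀ : Subfield Ω := Subfield.closure ((K : Set Ω) ∪ frobenius Ω p '' (F : Set Ω)) with hM₀
  have hzM₀ : z ∉ M₀ := not_mem_compositumPow_of_separating hz hsepz
  have hzpM₀ : z ^ p ∈ M₀ := Subfield.subset_closure (Or.inr ⟨z, hzF, frobenius_def ..⟩)
  -- `A = M₀⟮z⟯ ⊇ F`
  set A : IntermediateField M₀ Ω := IntermediateField.adjoin M₀ ({z} : Set Ω) with hA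
  have hFA : ∀ x ∈ F, x ∈ A := fun x hx => by
    rw [hA, mem_adjoin_subfield_iff]
    exact le_closure_compositumPow_insert hsepz hx
  -- `z` is integral over `M₀`: a root of `X^p - z^p`
  set c : M₀ := ⟨z ^ p, hzpM₀⟩ with hc
  have hP : (X ^ p - C c : Polynomial M₀).Monic := monic_X_pow_sub_C c hp.ne_zero
  have hPz : aeval z (X ^ p - C c : Polynomial M₀) = 0 := by
    rw [map_sub, map_pow, aeval_X, aeval_C]
    exact sub_self _
  have hint : IsIntegral M₀ z := ⟨_, hP, by rwa [← aeval_def]⟩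
  haveI : FiniteDimensional M₀ A := IntermediateField.adjoin.finiteDimensional hint
  -- the minimal polynomial of `z` over `M₀` is `(X - z)^p`
  set m : Polynomial M₀ := minpoly M₀ z with hm
  have hmdvd : m.map (algebraMap M₀ Ω) ∣ (X - C z) ^ p := by
    have h1 : m ∣ X ^ p - C c := minpoly.dvd M₀ z hPz
    have h2 := Polynomial.map_dvd (algebraMap M₀ Ω) h1
    rw [Polynomial.map_sub, Polynomial.map_pow, map_X, map_C] at h2
    have h3 : (X : Polynomial Ω) ^ p - C (algebraMap M₀ Ω c) = (X - C z) ^ p := by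
      rw [sub_pow_expChar, ← C_pow]
      rfl
    rwa [h3] at h2
  obtain ⟨k, hkp, hassoc⟩ := (dvd_prime_pow (prime_X_sub_C z) p).mp hmdvd
  have hmmonic : (m.map (algebraMap M₀ Ω)).Monic := (minpoly.monic hint).map _
  have hmeq : m.map (algebraMap M₀ Ω) = (X - C z) ^ k :=
    eq_of_monic_of_associated hmmonic ((monic_X_sub_C z).pow k) hassoc
  have hdeg : m.natDegree = k := by
    rw [← natDegree_map_eq_of_injective (algebraMap M₀ Ω).injective m, hmeq, natDegree_pow,
      natDegree_X_sub_C, mul_one]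
  have hk0 : 0 < k := by
    rw [← hdeg]
    exact minpoly.natDegree_pos hint
  have hkp' : k = p := by
    by_contra hne
    have hlt : k < p := lt_of_le_of_ne hkp hne
    -- the second coefficient `-k z` of `(X - z)^k` lies in `M₀`
    have hnext : (m.map (algebraMap M₀ Ω)).nextCoeff = k • (-z) := by
      rw [hmeq, (monic_X_sub_C z).nextCoeff_pow, nextCoeff_X_sub_C]
    rw [nextCoeff_map (algebraMap M₀ Ω).injective] at hnext
    have hmem : (k : Ω) * z ∈ M₀ := by
      have : algebraMap M₀ Ω m.nextCoeff = -((k : Ω) * z) := by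
        rw [hnext, nsmul_eq_mul, mul_neg]
      have h1 : -((k : Ω) * z) ∈ M₀ := this ▸ (m.nextCoeff).2
      simpa using M₀.neg_mem h1
    have hkne : (k : Ω) ≠ 0 := fun h0 => by
      rw [CharP.cast_eq_zero_iff Ω p] at h0
      exact absurd (Nat.le_of_dvd hk0 h0) (not_le.mpr hlt)
    have : z = ((k : Ω))⁻¹ * ((k : Ω) * z) := by rw [← mul_assoc, inv_mul_cancel₀ hkne, one_mul]
    exact hzM₀ (this ▸ M₀.mul_mem (M₀.inv_mem (natCast_mem M₀ k)) hmem)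
  have hfinA : Module.finrank M₀ A = p := by
    rw [hA, IntermediateField.adjoin.finrank hint, ← hm, hdeg, hkp']
  -- `B = M₀⟮y⟯` has degree dividing `p` and `> 1`, hence equals `A`
  set B : IntermediateField M₀ Ω := IntermediateField.adjoin M₀ ({y} : Set Ω) with hB
  have hBA : B ≤ A := by
    rw [hB, IntermediateField.adjoin_simple_le_iff]
    exact hFA y hyF
  have hyint : IsIntegral M₀ y := by
    have : IsIntegral M₀ (⟨y, hFA y hyF⟩ : A) := IsIntegral.of_finite M₀ _
    exact this.map (IntermediateField.val A)
  haveI : FiniteDimensional M₀ B := IntermediateField.adjoin.finiteDimensional hyint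
  have hdvd : Module.finrank M₀ B ∣ p := by
    rw [← hfinA]
    exact Dvd.intro _ (IntermediateField.finrank_bot_mul_relfinrank hBA)
  have hB1 : Module.finrank M₀ B ≠ 1 := fun h1 => by
    rw [IntermediateField.finrank_eq_one_iff, hB, IntermediateField.adjoin_simple_eq_bot_iff,
      IntermediateField.mem_bot] at h1
    obtain ⟨c', hc'⟩ := h1
    exact hy (hc' ▸ c'.2)
  have hfinB : Module.finrank M₀ B = p := by
    rcases (Nat.dvd_prime hp).mp hdvd with h1 | h1
    · exact absurd h1 hB1
    · exact h1
  have hBeqA : B = A := IntermediateField.eq_of_le_of_finrank_eq hBA (by rw [hfinB, hfinA])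
  -- conclusion
  intro x hx
  have hxB : x ∈ B := hBeqA ▸ hFA x hx
  rw [hB, mem_adjoin_subfield_iff] at hxB
  exact hxB

end CharP

/-! ### A transcendental element outside `K·F^p` is separating -/

section Separating

variable (p : ℕ) [Fact p.Prime] [CharP Ω p]

/-- **`F ⊆ K(y)·F^{p^m}` for all `m ≥ 1`** once `F ⊆ K(y)·F^p` (iterate Frobenius:
`F^p ⊆ (K(y)·F^{p^m})^p ⊆ K(y)·F^{p^{m+1}}`). [folklore] -/
theorem le_closure_adjoin_pow_iterate {K F : Subfield Ω} {y : Ω}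
    (h1 : F ≤ Subfield.closure
      ((Subfield.closure ((K : Set Ω) ∪ {y}) : Set Ω) ∪ frobenius Ω p '' (F : Set Ω)))
    (m : ℕ) (hm : 1 ≤ m) :
    F ≤ Subfield.closure
      ((Subfield.closure ((K : Set Ω) ∪ {y}) : Set Ω) ∪ (fun a : Ω => a ^ p ^ m) '' (F : Set Ω)) := by
  set E : Subfield Ω := Subfield.closure ((K : Set Ω) ∪ {y}) with hE
  have hEfrob : ∀ c ∈ E, frobenius Ω p c ∈ E := fun c hc => by
    rw [frobenius_def]
    exact E.pow_mem hc p
  induction m, hm using Nat.le_induction with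
  | base =>
    have : (fun a : Ω => a ^ p ^ 1) = frobenius Ω p := by
      funext a
      rw [pow_one, frobenius_def]
    rw [this]
    exact h1
  | succ m hm ih =>
    set Cm : Subfield Ω := Subfield.closure ((E : Set Ω) ∪ (fun a : Ω => a ^ p ^ m) '' (F : Set Ω))
      with hCm
    set Cm1 : Subfield Ω :=
      Subfield.closure ((E : Set Ω) ∪ (fun a : Ω => a ^ p ^ (m + 1)) '' (F : Set Ω)) with hCm1
    -- `F^p ⊆ (C_m)^p ⊆ C_{m+1}`
    have hfrobCm : Cm.map (frobenius Ω p) ≤ Cm1 := by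
      rw [hCm, RingHom.map_field_closure, Subfield.closure_le]
      rintro _ ⟨a, ha | ⟨b, hb, rfl⟩, rfl⟩
      · exact Subfield.subset_closure (Or.inl (hEfrob a ha))
      · refine Subfield.subset_closure (Or.inr ⟨b, hb, ?_⟩)
        change b ^ p ^ (m + 1) = frobenius Ω p (b ^ p ^ m)
        rw [frobenius_def, ← pow_mul, pow_succ]
    refine h1.trans (Subfield.closure_le.mpr (Set.union_subset ?_ ?_))
    · exact fun c hc => Subfield.subset_closure (Or.inl hc)
    · rintro _ ⟨b, hb, rfl⟩
      exact hfrobCm (Subfield.mem_map.mpr ⟨b, ih hb, rfl⟩)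

/-- **A transcendental element of `F` outside `K·F^p` is a separating element of `F|K`**
(`F|K` finitely generated with a separating element `z ∈ F`): `F = K·F^p(y) = K(y)·F^p`, hence
`F ⊆ K(y)·F^{p^n}` for the exponent `n` of `F` over the relative separable closure `S` of `K(y)`
in `F` (finite, `F` being finite over `K(y)` by the exchange property), and
`K(y)·F^{p^n} ⊆ S`. [folklore] -/
theorem isSeparable_adjoin_of_not_mem_compositumPow {K F : Subfield Ω} (hKF : K ≤ F)
    (hfg : FGOver K F) {z : Ω} (hz : Transcendental K z) (hzF : z ∈ F)
    (hsepz : ∀ b ∈ F, IsSeparable (Subfield.closure ((K : Set Ω) ∪ {z})) b) {y : Ω} (hyF : y ∈ F)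
    (hyt : Transcendental K y)
    (hy : y ∉ Subfield.closure ((K : Set Ω) ∪ frobenius Ω p '' (F : Set Ω))) :
    ∀ w ∈ F, IsSeparable (Subfield.closure ((K : Set Ω) ∪ {y})) w := by
  classical
  have hp : (p : ℕ).Prime := Fact.out
  set E : Subfield Ω := Subfield.closure ((K : Set Ω) ∪ {y}) with hE
  have hKE : K ≤ E := fun c hc => Subfield.subset_closure (Or.inl hc)
  have hyE : y ∈ E := Subfield.subset_closure (Or.inr rfl)
  have hEF : E ≤ F := Subfield.closure_le.mpr (Set.union_subset hKF (Set.singleton_subset_iff.mpr hyF))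
  -- (1) `F ⊆ K(y)·F^p`
  have h1 : F ≤ Subfield.closure ((E : Set Ω) ∪ frobenius Ω p '' (F : Set Ω)) := by
    refine (le_closure_compositumPow_insert_of_not_mem hz hzF hsepz hyF hy).trans
      (Subfield.closure_le.mpr (Set.union_subset ?_ ?_))
    · refine Subfield.closure_le.mpr (Set.union_subset (fun c hc => ?_) fun c hc => ?_)
      · exact Subfield.subset_closure (Or.inl (hKE hc))
      · exact Subfield.subset_closure (Or.inr hc)
    · exact Set.singleton_subset_iff.mpr (Subfield.subset_closure (Or.inl hyE))
  -- (2) `F` is algebraic over `E = K(y)` (exchange) and finite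
  have hzE : IsAlgebraic E z := by
    rw [hE, isAlgebraic_closure_iff]
    refine isAlgebraic_adjoin_swap hyt ?_
    exact (isAlgebraic_closure_iff K {z} y).mp (hsepz y hyF).isIntegral.isAlgebraic
  have halgE : ∀ x ∈ F, IsAlgebraic E x := fun x hx => by
    set Ez : Subfield Ω := Subfield.closure ((E : Set Ω) ∪ {z}) with hEz
    have hEEz : E ≤ Ez := fun c hc => Subfield.subset_closure (Or.inl hc)
    have hKzEz : Subfield.closure ((K : Set Ω) ∪ {z}) ≤ Ez :=
      Subfield.closure_mono (Set.union_subset_union_left _ hKE)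
    have hEz_alg : ∀ w ∈ Ez, IsAlgebraic E w := fun w hw =>
      isAlgebraic_of_mem_closure (fun u hu => by
        rw [Set.mem_singleton_iff] at hu
        rw [hu]
        exact hzE) hw
    exact isAlgebraic_trans_subfield hEEz hEz_alg
      (isAlgebraic_of_subfield_le hKzEz (hsepz x hx).isIntegral.isAlgebraic)
  set F' : IntermediateField E Ω := Subfield.extendScalars hEF with hF'
  obtain ⟨s, hs⟩ := hfg
  have hF'eq : F' = IntermediateField.adjoin E (↑s : Set Ω) := by
    apply IntermediateField.toSubfield_injective
    rw [hF', Subfield.extendScalars_toSubfield, adjoin_toSubfield_eq_closure]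
    refine le_antisymm ?_ (Subfield.closure_le.mpr (Set.union_subset hEF fun x hx => ?_))
    · rw [← hs]
      exact Subfield.closure_mono (Set.union_subset_union_left _ hKE)
    · exact hs ▸ Subfield.subset_closure (Or.inr hx)
  haveI : FiniteDimensional E F' := by
    rw [hF'eq]
    haveI : Finite (↑s : Set Ω) := s.finite_toSet.to_subtype
    exact IntermediateField.finiteDimensional_adjoin fun x hx =>
      (halgE x (hs ▸ Subfield.subset_closure (Or.inr (Finset.mem_coe.mp hx)))).isIntegral
  haveI : Algebra.IsAlgebraic E F' := Algebra.IsAlgebraic.of_finite E F'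
  -- (3) the relative separable closure and the exponent
  set S : IntermediateField E F' := separableClosure E F' with hS
  haveI : IsPurelyInseparable S F' := separableClosure.isPurelyInseparable E F'
  haveI : FiniteDimensional S F' := Module.Finite.of_restrictScalars_finite E S F'
  haveI : ExpChar E p := Subfield.expChar E p
  haveI : ExpChar S p := IntermediateField.expChar S p
  set n : ℕ := IsPurelyInseparable.exponent S F' with hn
  have hexp : ∀ a : F', a ^ p ^ n ∈ (algebraMap S F').range :=
    IsPurelyInseparable.exponent_def' S p
  -- (4) `F ⊆ K(y)·F^{p^(n+1)} ⊆ lift S`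
  set T : Subfield Ω := (IntermediateField.lift S).toSubfield with hT
  have hmemT : ∀ (x : Ω) (hx : x ∈ F), x ∈ T ↔ (⟨x, hx⟩ : F') ∈ S := fun x hx => by
    rw [hT, IntermediateField.mem_toSubfield]
    exact IntermediateField.mem_lift (⟨x, hx⟩ : F')
  have hET : E ≤ T := fun c hc => by
    rw [hmemT c (hEF hc)]
    exact S.algebraMap_mem ⟨c, hc⟩
  have hpowT : ∀ a ∈ F, a ^ p ^ (n + 1) ∈ T := fun a ha => by
    obtain ⟨t, ht⟩ := hexp (⟨a, ha⟩ ^ p)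
    have hmem : ((⟨a, ha⟩ : F') ^ p) ^ p ^ n ∈ S := by
      rw [← ht]
      exact (t : S).2
    have heq : (((⟨a, ha⟩ : F') ^ p) ^ p ^ n : F') = ⟨a ^ p ^ (n + 1), F.pow_mem ha _⟩ := by
      apply Subtype.ext
      simp only [SubmonoidClass.coe_pow]
      rw [← pow_mul, ← pow_succ']
    rw [hmemT _ (F.pow_mem ha _), ← heq]
    exact hmem
  have hFT : F ≤ T := by
    refine (le_closure_adjoin_pow_iterate p h1 (n + 1) (Nat.succ_le_succ (Nat.zero_le n))).trans ?_
    refine Subfield.closure_le.mpr (Set.union_subset hET ?_)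
    rintro _ ⟨a, ha, rfl⟩
    exact hpowT a ha
  -- (5) conclusion
  intro w hw
  have hwS : (⟨w, hw⟩ : F') ∈ S := (hmemT w hw).mp (hFT hw)
  have hsep : IsSeparable E (⟨w, hw⟩ : F') := mem_separableClosure_iff.mp hwS
  have hsep' : (minpoly E (⟨w, hw⟩ : F')).Separable := hsep
  rw [IntermediateField.minpoly_eq] at hsep'
  exact hsep'

end Separating

end Literature.AlgebraicGeometry.Resolution
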